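import Mathlib
import Summits.Ventures.PercRepro2.TypedTwoTerminal
import Summits.Ventures.PercRepro2.TypedRootBundleConn

/-!
# The root-bundle identity (blind cell PercRepro2, p2 g3, 2026-08-25)

A ROOT BUNDLE `H` (edges `L ⊆ F`, both ends in `I ∪ {v, a₁, a₂}`, `I` unmarked and internal) enters
the typed base of the crux kernel as TWO virtual edges `v–a₁`, `v–a₂` of types `k₁, k₂`:
`typedCount_rootBundle : N(B + H) = Σ_{k₁, k₂ ≤ 3} c_{k₁ k₂} · N(B + v–a₁(k₁) + v–a₂(k₂))`,
`c_{k₁ k₂}` = the number of typed placements of `L` joining `v` to `a₁` in exactly the first `k₁`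
copies, to `a₂` in exactly the next `k₂` copies, and never the two roots (`bundleCoeff`). The
placements joining the roots in some copy are killed by the kernel, and so are the terms of the
virtual count in which both virtual edges are open in a copy — which is why the identity is exact
although a copy joining `v` to both roots has several representations. The hat rule is the case
`I = {u}`; the bundle of several hats, of adjacent hats, of any unmarked part hanging on the root
pair and one more vertex, is a nonnegative integer combination of smaller instances
(`typedCount_nonneg_of_rootBundle`).
-/

namespace Summit.Ventures.PercRepro2

namespace CovForm

namespace TypedRed

namespace RootBundle

open TwoTerm

section Pattern

open Classical

variable {V : Type*} {E : Type*} [Fintype E] [DecidableEq E]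

/-- The flag pattern of a triple of placements: the first flags, then the second flags. -/
noncomputable def pat (ends : E → Sym2 V) (v a₁ a₂ : V) (p : Config E × Config E × Config E) :
    (Bool × Bool × Bool) × (Bool × Bool × Bool) :=
  ((flag₁ ends v a₁ a₂ p.1, flag₁ ends v a₁ a₂ p.2.1, flag₁ ends v a₁ a₂ p.2.2),
    (flag₂ ends v a₁ a₂ p.1, flag₂ ends v a₁ a₂ p.2.1, flag₂ ends v a₁ a₂ p.2.2))

/-- The number of placements of `L` with a given flag pattern. -/
noncomputable def patCountB (ends : E → Sym2 V) (L : Finset E) (τ : E → ℕ) (v a₁ a₂ : V)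
    (π : (Bool × Bool × Bool) × (Bool × Bool × Bool)) : ℕ :=
  ((placements L τ).filter fun p => pat ends v a₁ a₂ p = π).card

/-- The canonical pattern of weights `(k₁, k₂)`: the first `k₁` copies join `v` to `a₁`, the next
`k₂` join it to `a₂`. -/
def canonB : ℕ × ℕ → (Bool × Bool × Bool) × (Bool × Bool × Bool)
  | (0, 0) => ((false, false, false), (false, false, false))
  | (1, 0) => ((true, false, false), (false, false, false))
  | (2, 0) => ((true, true, false), (false, false, false))
  | (3, 0) => ((true, true, true), (false, false, false))
  | (0, 1) => ((false, false, false), (true, false, false))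
  | (0, 2) => ((false, false, false), (true, true, false))
  | (0, 3) => ((false, false, false), (true, true, true))
  | (1, 1) => ((true, false, false), (false, true, false))
  | (2, 1) => ((true, true, false), (false, false, true))
  | (1, 2) => ((true, false, false), (false, true, true))
  | _ => ((true, true, true), (true, true, true))

/-- **The coefficients of the root-bundle identity.** -/
noncomputable def bundleCoeff (ends : E → Sym2 V) (L : Finset E) (τ : E → ℕ) (v a₁ a₂ : V)
    (k₁ k₂ : ℕ) : ℕ :=
  patCountB ends L τ v a₁ a₂ (canonB (k₁, k₂))

/-- A pattern overlaps when some copy carries both flags. -/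
def Overlap (π : (Bool × Bool × Bool) × (Bool × Bool × Bool)) : Prop :=
  (π.1.1 = true ∧ π.2.1 = true) ∨ (π.1.2.1 = true ∧ π.2.2.1 = true) ∨
    (π.1.2.2 = true ∧ π.2.2.2 = true)

/-- Overlap is decidable. -/
instance instDecidableOverlap (π : (Bool × Bool × Bool) × (Bool × Bool × Bool)) :
    Decidable (Overlap π) := by
  unfold Overlap; infer_instance

/-- The weight of a flag triple. -/
def wt (p : Bool × Bool × Bool) : ℕ := p.1.toNat + p.2.1.toNat + p.2.2.toNat

/-- The pattern count is symmetric under exchanging the first two copies. -/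
lemma patCountB_swap12 (ends : E → Sym2 V) (L : Finset E) (τ : E → ℕ) (v a₁ a₂ : V)
    (p₁ p₂ p₃ q₁ q₂ q₃ : Bool) :
    patCountB ends L τ v a₁ a₂ ((p₂, p₁, p₃), (q₂, q₁, q₃)) =
      patCountB ends L τ v a₁ a₂ ((p₁, p₂, p₃), (q₁, q₂, q₃)) := by
  unfold patCountB
  refine Finset.card_nbij' (fun x => (x.2.1, x.1, x.2.2)) (fun x => (x.2.1, x.1, x.2.2)) ?_ ?_ ?_ ?_
  · rintro ⟨a, b, c⟩ h
    rw [Finset.mem_coe, Finset.mem_filter, mem_placements] at h ⊢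
    simp only [pat, Prod.mk.injEq] at h ⊢
    exact ⟨⟨⟨h.1.1.2.1, h.1.1.1, h.1.1.2.2⟩, isPlacement_swap12.2 h.1.2⟩,
      ⟨h.2.1.2.1, h.2.1.1, h.2.1.2.2⟩, ⟨h.2.2.2.1, h.2.2.1, h.2.2.2.2⟩⟩
  · rintro ⟨a, b, c⟩ h
    rw [Finset.mem_coe, Finset.mem_filter, mem_placements] at h ⊢
    simp only [pat, Prod.mk.injEq] at h ⊢
    exact ⟨⟨⟨h.1.1.2.1, h.1.1.1, h.1.1.2.2⟩, isPlacement_swap12.2 h.1.2⟩,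
      ⟨h.2.1.2.1, h.2.1.1, h.2.1.2.2⟩, ⟨h.2.2.2.1, h.2.2.1, h.2.2.2.2⟩⟩
  · rintro ⟨a, b, c⟩ _; rfl
  · rintro ⟨a, b, c⟩ _; rfl

/-- The pattern count is symmetric under exchanging the last two copies. -/
lemma patCountB_swap23 (ends : E → Sym2 V) (L : Finset E) (τ : E → ℕ) (v a₁ a₂ : V)
    (p₁ p₂ p₃ q₁ q₂ q₃ : Bool) :
    patCountB ends L τ v a₁ a₂ ((p₁, p₃, p₂), (q₁, q₃, q₂)) =
      patCountB ends L τ v a₁ a₂ ((p₁, p₂, p₃), (q₁, q₂, q₃)) := by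
  unfold patCountB
  refine Finset.card_nbij' (fun x => (x.1, x.2.2, x.2.1)) (fun x => (x.1, x.2.2, x.2.1)) ?_ ?_ ?_ ?_
  · rintro ⟨a, b, c⟩ h
    rw [Finset.mem_coe, Finset.mem_filter, mem_placements] at h ⊢
    simp only [pat, Prod.mk.injEq] at h ⊢
    exact ⟨⟨⟨h.1.1.1, h.1.1.2.2, h.1.1.2.1⟩, isPlacement_swap23.2 h.1.2⟩,
      ⟨h.2.1.1, h.2.1.2.2, h.2.1.2.1⟩, ⟨h.2.2.1, h.2.2.2.2, h.2.2.2.1⟩⟩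
  · rintro ⟨a, b, c⟩ h
    rw [Finset.mem_coe, Finset.mem_filter, mem_placements] at h ⊢
    simp only [pat, Prod.mk.injEq] at h ⊢
    exact ⟨⟨⟨h.1.1.1, h.1.1.2.2, h.1.1.2.1⟩, isPlacement_swap23.2 h.1.2⟩,
      ⟨h.2.1.1, h.2.1.2.2, h.2.1.2.1⟩, ⟨h.2.2.1, h.2.2.2.2, h.2.2.2.1⟩⟩
  · rintro ⟨a, b, c⟩ _; rfl
  · rintro ⟨a, b, c⟩ _; rfl

/-- A non-overlapping pattern count depends only on the two weights. -/
lemma patCountB_eq_coeff (ends : E → Sym2 V) (L : Finset E) (τ : E → ℕ) (v a₁ a₂ : V)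
    (π : (Bool × Bool × Bool) × (Bool × Bool × Bool)) (h : ¬ Overlap π) :
    patCountB ends L τ v a₁ a₂ π = bundleCoeff ends L τ v a₁ a₂ (wt π.1) (wt π.2) := by
  obtain ⟨⟨p₁, p₂, p₃⟩, ⟨q₁, q₂, q₃⟩⟩ := π
  unfold bundleCoeff wt
  cases p₁ <;> cases p₂ <;> cases p₃ <;> cases q₁ <;> cases q₂ <;> cases q₃ <;>
  first
    | exact absurd (by decide) h
    | rfl
    | (rw [← patCountB_swap12]; rfl)
    | (rw [← patCountB_swap23]; rfl)
    | (rw [← patCountB_swap12, ← patCountB_swap23]; rfl)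
    | (rw [← patCountB_swap23, ← patCountB_swap12]; rfl)
    | (rw [← patCountB_swap12, ← patCountB_swap23, ← patCountB_swap12]; rfl)

variable {R : Type*} [CommRing R]

/-- A placement sum of a function of the flag pattern, grouped by the pattern. -/
lemma sum_placements_pat (ends : E → Sym2 V) (L : Finset E) (τ : E → ℕ) (v a₁ a₂ : V)
    (T : (Bool × Bool × Bool) → (Bool × Bool × Bool) → R) :
    (∑ a ∈ suppL L, ∑ b ∈ suppL L, ∑ c ∈ suppL L,
        if IsPlacement L τ a b c then
          T (flag₁ ends v a₁ a₂ a, flag₁ ends v a₁ a₂ b, flag₁ ends v a₁ a₂ c)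
            (flag₂ ends v a₁ a₂ a, flag₂ ends v a₁ a₂ b, flag₂ ends v a₁ a₂ c) else 0) =
      ∑ π : (Bool × Bool × Bool) × (Bool × Bool × Bool),
        (patCountB ends L τ v a₁ a₂ π : R) * T π.1 π.2 := by
  have h1 : (∑ a ∈ suppL L, ∑ b ∈ suppL L, ∑ c ∈ suppL L,
      if IsPlacement L τ a b c then
        T (flag₁ ends v a₁ a₂ a, flag₁ ends v a₁ a₂ b, flag₁ ends v a₁ a₂ c)
          (flag₂ ends v a₁ a₂ a, flag₂ ends v a₁ a₂ b, flag₂ ends v a₁ a₂ c) else 0) =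
      ∑ p ∈ placements L τ, T (pat ends v a₁ a₂ p).1 (pat ends v a₁ a₂ p).2 := by
    unfold placements
    rw [Finset.sum_filter, Finset.sum_product]
    refine Finset.sum_congr rfl fun a _ => ?_
    rw [Finset.sum_product]
    rfl
  rw [h1, ← Finset.sum_fiberwise_of_maps_to
    (t := (Finset.univ : Finset ((Bool × Bool × Bool) × (Bool × Bool × Bool))))
    (g := pat ends v a₁ a₂) (fun _ _ => Finset.mem_univ _)]
  refine Finset.sum_congr rfl fun π _ => ?_
  rw [Finset.sum_congr rfl fun p hp => by rw [(Finset.mem_filter.1 hp).2]]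
  rw [Finset.sum_const, nsmul_eq_mul]
  rfl

/-- Grouping the `64` patterns by their two weights. -/
lemma sum_pat_weight (c : ℕ → ℕ → ℕ) (T : (Bool × Bool × Bool) → (Bool × Bool × Bool) → R) :
    (∑ π : (Bool × Bool × Bool) × (Bool × Bool × Bool),
        ((c (wt π.1) (wt π.2) : ℕ) : R) * T π.1 π.2) =
      ∑ k₁ ∈ Finset.range 4, ∑ k₂ ∈ Finset.range 4, ((c k₁ k₂ : ℕ) : R) *
        ∑ q₁ : Bool, ∑ q₂ : Bool, ∑ q₃ : Bool,
          if q₁.toNat + q₂.toNat + q₃.toNat = k₂ then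
            ∑ p₁ : Bool, ∑ p₂ : Bool, ∑ p₃ : Bool,
              if p₁.toNat + p₂.toNat + p₃.toNat = k₁ then T (p₁, p₂, p₃) (q₁, q₂, q₃) else 0
          else 0 := by
  simp only [Fintype.sum_prod_type, Fintype.sum_bool, Finset.sum_range_succ, Finset.sum_range_zero,
    wt]
  simp
  ring

end Pattern

/-! ## The identity -/

section Identity

open Classical OneTyped

variable {V : Type*} {E : Type*} [Fintype E] [DecidableEq E] {R : Type*} [Field R]

/-- A pointwise zero kernel has typed count `0`. -/
lemma typedCount_K_zero (F : Finset E) (z : Config E) (τ : E → ℕ) :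
    typedCount F z τ (fun _ _ _ => (0 : R)) = 0 := by
  unfold typedCount
  simp

/-- **The root-bundle identity for the crux kernel**: a bundle `H` hanging on the roots and one
more vertex `v` is the two virtual edges `v–a₁`, `v–a₂` of types `k₁, k₂` with the multiplicities
`bundleCoeff`. -/
theorem typedCount_rootBundle (ends : E → Sym2 V) (o a₁ a₂ a₃ b : V) {I : Set V} {v : V}
    (hv : v ∉ I) (hI : ∀ x ∈ I, x ≠ o ∧ x ≠ a₁ ∧ x ≠ a₂ ∧ x ≠ a₃ ∧ x ≠ b)
    {L : Finset E} (hLI : ∀ e ∈ L, ∀ x ∈ ends e, x ∈ I ∨ x = v ∨ x = a₁ ∨ x = a₂)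
    {h₁ h₂ : E} (h₁L : h₁ ∈ L) (h₂L : h₂ ∈ L) (h12 : h₁ ≠ h₂) {F : Finset E} (hLF : L ⊆ F)
    (z : Config E) (τ : E → ℕ)
    (hcl : ∀ e, e ∉ L → (∃ x ∈ I, x ∈ ends e) → e ∉ F ∧ z e = false) :
    typedCount F z τ (K3 ends o a₁ a₂ a₃ b : Config E → Config E → Config E → R) =
      ∑ k₁ ∈ Finset.range 4, ∑ k₂ ∈ Finset.range 4,
        (bundleCoeff ends L τ v a₁ a₂ k₁ k₂ : R) *
          typedCount (insert h₂ (insert h₁ (F \ L))) (offL L z)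
            (Function.update (Function.update τ h₁ k₁) h₂ k₂)
            (K3 (Function.update (Function.update ends h₁ s(v, a₁)) h₂ s(v, a₂)) o a₁ a₂ a₃ b) := by
  set ends' := Function.update (Function.update ends h₁ s(v, a₁)) h₂ s(v, a₂) with hends'
  have hh₁ : h₁ ∉ F \ L := fun h => (Finset.mem_sdiff.1 h).2 h₁L
  have hh₂ : h₂ ∉ insert h₁ (F \ L) := by
    rw [Finset.mem_insert, not_or]
    exact ⟨Ne.symm h12, fun h => (Finset.mem_sdiff.1 h).2 h₂L⟩
  -- the pieces
  set T : (Bool × Bool × Bool) → (Bool × Bool × Bool) → R := fun p q =>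
    typedCount (F \ L) (offL L z) τ (fun x y w => K3 ends' o a₁ a₂ a₃ b
      (Function.update (Function.update x h₁ p.1) h₂ q.1)
      (Function.update (Function.update y h₁ p.2.1) h₂ q.2.1)
      (Function.update (Function.update w h₁ p.2.2) h₂ q.2.2)) with hT
  -- the kernel at a placement is the kernel of the virtual edges
  have hK : ∀ a b' c : Config E, a ∈ suppL L → b' ∈ suppL L → c ∈ suppL L →
      typedCount (F \ L) (offL L z) τ (fun x y w => K3 ends o a₁ a₂ a₃ b
        (patchL L a x) (patchL L b' y) (patchL L c w)) =
      T (flag₁ ends v a₁ a₂ a, flag₁ ends v a₁ a₂ b', flag₁ ends v a₁ a₂ c)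
        (flag₂ ends v a₁ a₂ a, flag₂ ends v a₁ a₂ b', flag₂ ends v a₁ a₂ c) := by
    intro a b' c ha hb hc
    rw [hT]
    refine typedCount_congr_K_on _ _ _ fun x y w hxyw _ => ?_
    have hsupp : ∀ x' : Config E, (∀ e, e ∉ F \ L → x' e = offL L z e) →
        (∀ e ∈ L, x' e = false) ∧ ∀ e, e ∉ L → (∃ u ∈ I, u ∈ ends e) → x' e = false := by
      intro x' hx'
      refine ⟨fun e he => ?_, fun e heL hu => ?_⟩
      · have := hx' e fun h => (Finset.mem_sdiff.1 h).2 he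
        rwa [offL_of_mem he] at this
      · obtain ⟨heF, hze⟩ := hcl e heL hu
        rw [hx' e fun h => heF (Finset.mem_sdiff.1 h).1, offL_of_not_mem heL, hze]
    have hx := hsupp x fun e he => (hxyw e he).1
    have hy := hsupp y fun e he => (hxyw e he).2.1
    have hw := hsupp w fun e he => (hxyw e he).2.2
    exact K3_rootBundle ends o a₁ a₂ a₃ b hv hI hLI h₁L h₂L h12 (mem_suppL.1 ha) (mem_suppL.1 hb)
      (mem_suppL.1 hc) hx.1 hy.1 hw.1 hx.2 hy.2 hw.2
  -- overlapping patterns vanish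
  have hT0 : ∀ p q : Bool × Bool × Bool, Overlap (p, q) → T p q = 0 := by
    intro p q hov
    rw [hT]
    simp only
    rw [typedCount_congr_K_on _ _ _ (K' := fun _ _ _ => (0 : R)) fun x y w _ _ => ?_]
    · exact typedCount_K_zero _ _ _
    refine K3_eq_zero_of_conn_roots _ o a₁ a₂ a₃ b ?_
    rcases hov with ⟨hp, hq⟩ | ⟨hp, hq⟩ | ⟨hp, hq⟩
    · exact Or.inl (by rw [hp, hq]; exact conn_roots_of_flags ends h12 x)
    · exact Or.inr (Or.inl (by rw [hp, hq]; exact conn_roots_of_flags ends h12 y))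
    · exact Or.inr (Or.inr (by rw [hp, hq]; exact conn_roots_of_flags ends h12 w))
  -- the right-hand pieces
  have hR : ∀ k₁ k₂ : ℕ, typedCount (insert h₂ (insert h₁ (F \ L))) (offL L z)
      (Function.update (Function.update τ h₁ k₁) h₂ k₂)
      (K3 ends' o a₁ a₂ a₃ b : Config E → Config E → Config E → R) =
      ∑ q₁ : Bool, ∑ q₂ : Bool, ∑ q₃ : Bool,
        if q₁.toNat + q₂.toNat + q₃.toNat = k₂ then
          ∑ p₁ : Bool, ∑ p₂ : Bool, ∑ p₃ : Bool,
            if p₁.toNat + p₂.toNat + p₃.toNat = k₁ then T (p₁, p₂, p₃) (q₁, q₂, q₃) else 0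
        else 0 := by
    intro k₁ k₂
    rw [typedCount_split (insert h₂ (insert h₁ (F \ L))) h₂ (Finset.mem_insert_self _ _)]
    refine Finset.sum_congr rfl fun q₁ _ => Finset.sum_congr rfl fun q₂ _ =>
      Finset.sum_congr rfl fun q₃ _ => ?_
    rw [Function.update_self]
    refine if_congr Iff.rfl ?_ rfl
    rw [Finset.erase_insert hh₂,
      typedCount_split (insert h₁ (F \ L)) h₁ (Finset.mem_insert_self _ _)]
    refine Finset.sum_congr rfl fun p₁ _ => Finset.sum_congr rfl fun p₂ _ =>
      Finset.sum_congr rfl fun p₃ _ => ?_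
    rw [Function.update_of_ne h12, Function.update_self]
    refine if_congr Iff.rfl ?_ rfl
    rw [hT]
    simp only
    rw [Finset.erase_insert hh₁]
    have hz : Function.update (Function.update (offL L z) h₂ false) h₁ false = offL L z := by
      have e2 : Function.update (offL L z) h₂ false = offL L z := by
        conv_lhs => rw [← offL_of_mem (ω := z) h₂L]
        exact Function.update_eq_self h₂ (offL L z)
      rw [e2]
      conv_lhs => rw [← offL_of_mem (ω := z) h₁L]
      exact Function.update_eq_self h₁ (offL L z)
    rw [hz]
    have hτ' : ∀ e ∈ F \ L, Function.update (Function.update τ h₁ k₁) h₂ k₂ e = τ e := by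
      intro e he
      rw [Function.update_of_ne (fun h => hh₂ (by rw [← h]; exact Finset.mem_insert_of_mem he)),
        Function.update_of_ne (fun h => hh₁ (by rw [← h]; exact he))]
    rw [typedCount_congr_τ _ _ hτ' _]
  -- assembly
  have hmid : (∑ a ∈ suppL L, ∑ b' ∈ suppL L, ∑ c ∈ suppL L,
      if IsPlacement L τ a b' c then typedCount (F \ L) (offL L z) τ
        (fun x y w => K3 ends o a₁ a₂ a₃ b (patchL L a x) (patchL L b' y) (patchL L c w)) else 0) =
      ∑ a ∈ suppL L, ∑ b' ∈ suppL L, ∑ c ∈ suppL L,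
        if IsPlacement L τ a b' c then
          T (flag₁ ends v a₁ a₂ a, flag₁ ends v a₁ a₂ b', flag₁ ends v a₁ a₂ c)
            (flag₂ ends v a₁ a₂ a, flag₂ ends v a₁ a₂ b', flag₂ ends v a₁ a₂ c) else 0 :=
    Finset.sum_congr rfl fun a ha => Finset.sum_congr rfl fun b' hb =>
      Finset.sum_congr rfl fun c hc => by
        by_cases hP : IsPlacement L τ a b' c
        · rw [if_pos hP, if_pos hP, hK a b' c ha hb hc]
        · rw [if_neg hP, if_neg hP]
  have hpat : (∑ π : (Bool × Bool × Bool) × (Bool × Bool × Bool),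
      (patCountB ends L τ v a₁ a₂ π : R) * T π.1 π.2) =
      ∑ π : (Bool × Bool × Bool) × (Bool × Bool × Bool),
        ((bundleCoeff ends L τ v a₁ a₂ (wt π.1) (wt π.2) : ℕ) : R) * T π.1 π.2 :=
    Finset.sum_congr rfl fun π _ => by
      by_cases hov : Overlap π
      · rw [hT0 π.1 π.2 hov, mul_zero, mul_zero]
      · rw [patCountB_eq_coeff ends L τ v a₁ a₂ π hov]
  rw [typedCount_split_finset F L hLF z τ, hmid, sum_placements_pat ends L τ v a₁ a₂ T, hpat,
    sum_pat_weight (bundleCoeff ends L τ v a₁ a₂) T]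
  simp only [hR]

end Identity

/-! ## The reduction rule -/

section Reduction

open Classical

variable {V : Type*} {E : Type*} [Fintype E] [DecidableEq E] {R : Type*} [Field R] [LinearOrder R]
  [IsStrictOrderedRing R]

/-- **The root-bundle reduction**: row 2′TRI on the sixteen instances `B + v–a₁(k₁) + v–a₂(k₂)`
gives it on `B + H`. -/
theorem typedCount_nonneg_of_rootBundle (ends : E → Sym2 V) (o a₁ a₂ a₃ b : V) {I : Set V}
    {v : V} (hv : v ∉ I) (hI : ∀ x ∈ I, x ≠ o ∧ x ≠ a₁ ∧ x ≠ a₂ ∧ x ≠ a₃ ∧ x ≠ b)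
    {L : Finset E} (hLI : ∀ e ∈ L, ∀ x ∈ ends e, x ∈ I ∨ x = v ∨ x = a₁ ∨ x = a₂)
    {h₁ h₂ : E} (h₁L : h₁ ∈ L) (h₂L : h₂ ∈ L) (h12 : h₁ ≠ h₂) {F : Finset E} (hLF : L ⊆ F)
    (z : Config E) (τ : E → ℕ)
    (hcl : ∀ e, e ∉ L → (∃ x ∈ I, x ∈ ends e) → e ∉ F ∧ z e = false)
    (h : ∀ k₁ k₂, k₁ ≤ 3 → k₂ ≤ 3 →
      0 ≤ typedCount (insert h₂ (insert h₁ (F \ L))) (offL L z)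
        (Function.update (Function.update τ h₁ k₁) h₂ k₂)
        (K3 (Function.update (Function.update ends h₁ s(v, a₁)) h₂ s(v, a₂)) o a₁ a₂ a₃ b :
          Config E → Config E → Config E → R)) :
    0 ≤ typedCount F z τ (K3 ends o a₁ a₂ a₃ b : Config E → Config E → Config E → R) := by
  rw [typedCount_rootBundle ends o a₁ a₂ a₃ b hv hI hLI h₁L h₂L h12 hLF z τ hcl]
  refine Finset.sum_nonneg fun k₁ hk₁ => Finset.sum_nonneg fun k₂ hk₂ => mul_nonneg
    (Nat.cast_nonneg _) (h k₁ k₂ (Nat.lt_succ_iff.1 (Finset.mem_range.1 hk₁))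
      (Nat.lt_succ_iff.1 (Finset.mem_range.1 hk₂)))

end Reduction

end RootBundle

end TypedRed

end CovForm

end Summit.Ventures.PercRepro2
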